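import Literature.AlgebraicGeometry.ModuliOfAbelianVarieties.RelativeExponentialChartPairingReadings   -- ★ LOCAL head `eventually_pairingReading_eq`
import Mathlib.Topology.Connected.TotallyDisconnected
import HarnessLib

/-!
# The Weil-pairing readings of the chart frame are CONSTANT on a connected chart domain — interface (W=) of FLAT-c
# ([MumfordAV1970] §20; [BirkenhakeLange2004] §8.7 Lemma 8.7.1; [DeligneHodgeII1971] §4.4 (4.4.2)–(4.4.3))

Layer `Literature/AlgebraicGeometry/ModuliOfAbelianVarieties`, namespace
`Literature.AlgebraicGeometry.ModuliOfAbelianVarieties.RelativeExponentialChartPairingReadings`.  THEOREMS ONLY (no definition, no named fact, no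
instance, no notation, no `sorry`).  Cell `hodgecm-mathlib` (D-0151), FLOOR 0, P6 «MOD» (crux hLiu418 = stmt-HodgeConjecture-24832, `--supports`), half A
line L7, socket `stub_UNIVFAM` (★ P-3), organ O3 `stub_FLAT`, sub-organ **FLAT-b(ii) «PAIRING READINGS CONSTANT ALONG A CHART», GLOBAL HEAD = the
conclusion (W=) of LA7-p01 (g0)'s FLAT-b ⇄ FLAT-c interface v1 token for token** (LA7-plan RULING 2026-09-02T02:22Z (3)–(4)).  HC_CM is proved only
modulo the printed citations until rung 0 closes; count-neutral.

THE MATHEMATICS.  ★ `eventually_pairingReading_eq` (the local head): near every point of the chart domain `V` the Weil pairing of the chart points of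
fixed rational readings `v, w` is constant.  At every `s ∈ V` such chart points EXIST and are `M`-torsion (the readings are `M`-division vectors,
read through the additive fibre analytification (G)), and ample witnesses of `λ` exist (★ `Polarization.exists_ample`); so «all pairing readings at
`s` equal the one at `t₀`» is a LOCALLY CONSTANT predicate on `V`, hence constant on a PRECONNECTED `V` (Mathlib `IsPreconnected.constant`): the
pairing readings at `t` and `t₀` agree for all `t ∈ V` (`pairingReading_const`).  In print: the polarisation form `E` on the local system `R₁f_*ℤ`
is flat ([DeligneHodgeII1971] (4.4.3)); [BirkenhakeLange2004] §8.7 Lemma 8.7.1 for the universal family.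

## References
* [MumfordAV1970] D. Mumford, *Abelian Varieties* (1970), §20 (pp. 183–185).
* [BirkenhakeLange2004] C. Birkenhake, H. Lange, *Complex Abelian Varieties*, 2nd ed. (2004), Ch. 8 §8.7 Lemma 8.7.1 pp. 229–231.
* [DeligneHodgeII1971] P. Deligne, *Théorie de Hodge II*, Publ. Math. IHÉS 40 (1971), §4.4 (4.4.2)–(4.4.3) pp. 50–51.
-/

set_option autoImplicit false

noncomputable section

universe u

open CategoryTheory CategoryTheory.Limits AlgebraicGeometry Topology Set Function Filter
open scoped Manifold MonObj
open Literature.AlgebraicGeometry.Motives (SchemeOver ComplexPoints AlgPoints specOver AbelianVariety CartierDivisor)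
open Literature.AlgebraicGeometry.AbelianSchemes (PolarizedAbelianSchemeWithLevel AbelianSchemeOver)
open Literature.Geometry.Kaehler (ComplexTorus)
open Literature.Geometry.Kaehler.ComplexTorus (cover proj)
open Literature.Geometry.ComplexAnalytic (IsRelExpChartOn totalOver projOver basePoint)
open Literature.NumberTheory.Transcendental (IsAnalytification)

namespace Literature.AlgebraicGeometry.ModuliOfAbelianVarieties

namespace RelativeExponentialChartPairingReadings

variable {g d : ℕ} {T : SchemeOver ℂ}
  {MT : Type} [TopologicalSpace MT] [ChartedSpace (Fin d → ℂ) MT] {φT : MT → ComplexPoints T}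
  {MA : Type} [TopologicalSpace MA] [ChartedSpace (Fin (d + g) → ℂ) MA]

/-- Powers of an additive map from the torus: `φ (m • τ) = (φ τ) ^ m` (plumbing). [folklore] -/
private theorem map_nsmul_eq_pow' {Φ : (Fin g ⊕ Fin g → ℝ) ≃L[ℝ] (Fin g → ℂ)} {G : Type*} [Group G]
    (φ : ComplexTorus Φ → G) (hadd : ∀ x y, φ (x + y) = φ x * φ y) (τ : ComplexTorus Φ) (m : ℕ) : φ (m • τ) = φ τ ^ m := by
  have h0 : φ 0 = 1 := by
    have h := hadd 0 0
    rw [add_zero] at h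
    exact (mul_eq_left.1 h.symm)
  induction m with
  | zero => simp [h0]
  | succ k ih => rw [succ_nsmul, hadd, ih, pow_succ]

/-- An element of the real torus killed by `m` lifts to an `m`-division vector (plumbing). [folklore] -/
private theorem exists_isDiv_of_nsmul_eq_zero' {Φ : (Fin g ⊕ Fin g → ℝ) ≃L[ℝ] (Fin g → ℂ)} {τ : ComplexTorus Φ} {m : ℕ}
    (hτ : m • τ = 0) : ∃ x : Fin g ⊕ Fin g → ℝ, (∀ i, ∃ k : ℤ, (m : ℝ) * x i = k) ∧ proj Φ x = τ := by
  refine ⟨ComplexTorus.lift Φ τ, fun i => ?_, ComplexTorus.proj_lift Φ τ⟩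
  have hi : m • ((τ : (Fin g ⊕ Fin g) → AddCircle (1 : ℝ)) i) = 0 :=
    congrArg (fun f : ComplexTorus Φ => (f : (Fin g ⊕ Fin g) → AddCircle (1 : ℝ)) i) hτ
  have hlift : ((ComplexTorus.lift Φ τ i : ℝ) : AddCircle (1 : ℝ)) = (τ : (Fin g ⊕ Fin g) → AddCircle (1 : ℝ)) i := by
    have := congrArg (fun f : ComplexTorus Φ => (f : (Fin g ⊕ Fin g) → AddCircle (1 : ℝ)) i) (ComplexTorus.proj_lift Φ τ)
    simpa only [ComplexTorus.proj_apply] using this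
  have h2 : ((((m : ℝ) * ComplexTorus.lift Φ τ i : ℝ)) : AddCircle (1 : ℝ)) = 0 := by
    rw [← nsmul_eq_mul, AddCircle.coe_nsmul, hlift]
    exact hi
  obtain ⟨k, hk⟩ := (AddCircle.coe_eq_zero_iff (1 : ℝ)).1 h2
  exact ⟨k, by rw [← hk, zsmul_eq_mul, mul_one]⟩

omit [TopologicalSpace MT] [ChartedSpace (Fin d → ℂ) MT] in
/-- The chart reading of an `M`-torsion fibre point is an `M`-division vector (through (G); plumbing). [folklore] -/
private theorem exists_isDiv_reading_of_pow_eq_one' (A : AbelianSchemeOver T.left) (φA : MA → ComplexPoints (totalOver T A))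
    (hA : IsAnalytification (Fin (d + g) → ℂ) (totalOver T A) (d + g) φA)
    {Φ₁ : MT → ((Fin g ⊕ Fin g → ℝ) ≃L[ℝ] (Fin g → ℂ))} {ex₁ : MT × (Fin g → ℂ) → MA} {s : MT}
    (hGs : ∃ φt : ComplexTorus (Φ₁ s) → (A.fibre (φT s).left).toAbelianVariety.Points ℂ,
      IsAnalytification (Fin g → ℂ) (A.fibre (φT s).left).toAbelianVariety.X g φt ∧
      (∀ x y, φt (x + y) = φt x * φt y) ∧
      ∀ z : Fin g → ℂ, (φA (ex₁ (s, z))).left = A.fibrePointToLeft (φT s).left (φt (cover (Φ₁ s) z)))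
    {m : ℕ} (Q : (A.fibre (φT s).left).toAbelianVariety.Points ℂ) (hQ : Q ^ m = 1) {a : MA}
    (ha : (φA a).left = A.fibrePointToLeft (φT s).left Q) :
    ∃ x : Fin g ⊕ Fin g → ℝ, (∀ i, ∃ k : ℤ, (m : ℝ) * x i = k) ∧ a = ex₁ (s, Φ₁ s x) := by
  obtain ⟨φt, hφt, hadd, hcomp⟩ := hGs
  obtain ⟨τ, hτ⟩ := hφt.isHomeomorph.surjective Q
  have h1 : φt 0 = 1 := by
    have := map_nsmul_eq_pow' φt hadd 0 0
    rwa [zero_nsmul, pow_zero] at this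
  have hτm : m • τ = 0 := by
    apply hφt.isHomeomorph.injective
    rw [map_nsmul_eq_pow' φt hadd τ m, hτ, h1]
    exact hQ
  obtain ⟨x, hxdiv, hxτ⟩ := exists_isDiv_of_nsmul_eq_zero' hτm
  refine ⟨x, hxdiv, hA.isHomeomorph.injective (Over.OverMorphism.ext ?_)⟩
  rw [hcomp, ComplexTorus.cover_apply_apply, hxτ, hτ]
  exact ha

/-- An `m`-division vector projects to an `m`-torsion element of the real torus (plumbing). [folklore] -/
private theorem nsmul_proj_eq_zero {Φ : (Fin g ⊕ Fin g → ℝ) ≃L[ℝ] (Fin g → ℂ)} {m : ℕ} {x : Fin g ⊕ Fin g → ℝ}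
    (hx : ∀ i, ∃ k : ℤ, (m : ℝ) * x i = k) : m • proj Φ x = 0 := by
  funext i
  obtain ⟨k, hk⟩ := hx i
  change m • (proj Φ x : (Fin g ⊕ Fin g) → AddCircle (1 : ℝ)) i = 0
  rw [ComplexTorus.proj_apply, ← AddCircle.coe_nsmul, nsmul_eq_mul, hk]
  exact (AddCircle.coe_eq_zero_iff (1 : ℝ)).2 ⟨k, by simp⟩

omit [TopologicalSpace MT] [ChartedSpace (Fin d → ℂ) MT] [TopologicalSpace MA] [ChartedSpace (Fin (d + g) → ℂ) MA] in
/-- **Chart points of an `M`-division reading are `M`-torsion points of the fibre** (through (G); plumbing): at `s`, for an `M`-division vector `ṽ`,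
there is an `M`-torsion point `Q` of `A_s` with `fibrePointToLeft Q = (φA (ex₁ (s, Φ₁ s ṽ))).left`. [folklore] -/
private theorem exists_torsionPoint_reading (A : AbelianSchemeOver T.left) (φA : MA → ComplexPoints (totalOver T A))
    {Φ₁ : MT → ((Fin g ⊕ Fin g → ℝ) ≃L[ℝ] (Fin g → ℂ))} {ex₁ : MT × (Fin g → ℂ) → MA} {s : MT}
    (hGs : ∃ φt : ComplexTorus (Φ₁ s) → (A.fibre (φT s).left).toAbelianVariety.Points ℂ,
      IsAnalytification (Fin g → ℂ) (A.fibre (φT s).left).toAbelianVariety.X g φt ∧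
      (∀ x y, φt (x + y) = φt x * φt y) ∧
      ∀ z : Fin g → ℂ, (φA (ex₁ (s, z))).left = A.fibrePointToLeft (φT s).left (φt (cover (Φ₁ s) z)))
    {M : ℕ} {x : Fin g ⊕ Fin g → ℝ} (hx : ∀ i, ∃ k : ℤ, (M : ℝ) * x i = k) :
    ∃ Q : (A.fibre (φT s).left).toAbelianVariety.torsionPoints ℂ (M : ℤ),
      A.fibrePointToLeft (φT s).left (Q : (A.fibre (φT s).left).toAbelianVariety.Points ℂ) = (φA (ex₁ (s, Φ₁ s x))).left := by
  obtain ⟨φt, -, hadd, hcomp⟩ := hGs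
  refine ⟨⟨φt (proj (Φ₁ s) x), (AbelianVariety.mem_torsionPoints_iff _ _).2 ?_⟩, ?_⟩
  · rw [zpow_natCast, ← map_nsmul_eq_pow' φt hadd, nsmul_proj_eq_zero hx]
    have := map_nsmul_eq_pow' φt hadd 0 0
    rwa [zero_nsmul, pow_zero] at this
  · rw [hcomp, ComplexTorus.cover_apply_apply]

/-- **FLAT-b(ii) (W=) — THE WEIL-PAIRING READINGS OF THE CHART FRAME ARE CONSTANT ON A PRECONNECTED CHART DOMAIN** ([MumfordAV1970] §20;
[BirkenhakeLange2004] §8.7 Lemma 8.7.1; [DeligneHodgeII1971] (4.4.3)): under the hypotheses of ★ `eventually_pairingReading_eq` with `V` preconnected,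
for `t₀, t ∈ V`, `(M : ℂ) ≠ 0`, rational `v, w`, torsion points `Pt, Qt ∈ A_t[M]` and `P₀, Q₀ ∈ A_{t₀}[M]` which are the chart points of readings
`v, w` at `t` resp. `t₀`, and ANY witnesses `Θ` of `λ` at `t` and `Θ₀` at `t₀`: `ē^Θ_M(Pt, Qt) = ē^{Θ₀}_M(P₀, Q₀)` — the hypothesis `hpair` of FLAT-c's
head, token for token.
[cite: MumfordAV1970, §20 (pp. 183–185)] [cite: BirkenhakeLange2004, §8.7 Lemma 8.7.1] [cite: DeligneHodgeII1971, §4.4 (4.4.2)–(4.4.3) pp. 50–51] -/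
theorem pairingReading_const {N : ℕ} {δ : Fin g → ℕ} [IsSeparated T.hom] [SmoothOfRelativeDimension d T.hom]
    (P : PolarizedAbelianSchemeWithLevel g N δ T.left)
    (hT : IsAnalytification (Fin d → ℂ) T d φT)
    (φA : MA → ComplexPoints (totalOver T P.A)) (hA : IsAnalytification (Fin (d + g) → ℂ) (totalOver T P.A) (d + g) φA)
    {V : Set MT} {Φ₁ : MT → ((Fin g ⊕ Fin g → ℝ) ≃L[ℝ] (Fin g → ℂ))} {ex₁ : MT × (Fin g → ℂ) → MA}
    (hex₁ : IsRelExpChartOn (Fin d → ℂ) (Fin (d + g) → ℂ) (basePoint hT P.A φA) V Φ₁ ex₁) (hV : IsPreconnected V)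
    (hG : ∀ t ∈ V, ∃ φt : ComplexTorus (Φ₁ t) → (P.A.fibre (φT t).left).toAbelianVariety.Points ℂ,
      IsAnalytification (Fin g → ℂ) (P.A.fibre (φT t).left).toAbelianVariety.X g φt ∧
      (∀ x y, φt (x + y) = φt x * φt y) ∧
      ∀ z : Fin g → ℂ, (φA (ex₁ (t, z))).left = P.A.fibrePointToLeft (φT t).left (φt (cover (Φ₁ t) z)))
    {t₀ t : MT} (ht₀ : t₀ ∈ V) (ht : t ∈ V)
    (Θ₀ : CartierDivisor (P.A.fibre (φT t₀).left).toAbelianVariety.X.left) (hlam₀ : P.A.IsLambdaOfAt (φT t₀).left P.D P.pol.lam Θ₀)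
    (Θ : CartierDivisor (P.A.fibre (φT t).left).toAbelianVariety.X.left) (hlam : P.A.IsLambdaOfAt (φT t).left P.D P.pol.lam Θ) :
    ∀ ⦃M : ℕ⦄ (hMΩ : (M : ℂ) ≠ 0) (v w : Fin g ⊕ Fin g → ℚ)
      (Pt Qt : (P.A.fibre (φT t).left).toAbelianVariety.torsionPoints ℂ (M : ℤ))
      (P₀ Q₀ : (P.A.fibre (φT t₀).left).toAbelianVariety.torsionPoints ℂ (M : ℤ)),
      P.A.fibrePointToLeft (φT t).left (Pt : (P.A.fibre (φT t).left).toAbelianVariety.Points ℂ) =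
          (φA (ex₁ (t, Φ₁ t (fun j => (v j : ℝ))))).left →
      P.A.fibrePointToLeft (φT t).left (Qt : (P.A.fibre (φT t).left).toAbelianVariety.Points ℂ) =
          (φA (ex₁ (t, Φ₁ t (fun j => (w j : ℝ))))).left →
      P.A.fibrePointToLeft (φT t₀).left (P₀ : (P.A.fibre (φT t₀).left).toAbelianVariety.Points ℂ) =
          (φA (ex₁ (t₀, Φ₁ t₀ (fun j => (v j : ℝ))))).left →
      P.A.fibrePointToLeft (φT t₀).left (Q₀ : (P.A.fibre (φT t₀).left).toAbelianVariety.Points ℂ) =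
          (φA (ex₁ (t₀, Φ₁ t₀ (fun j => (w j : ℝ))))).left →
      haveI := AbelianVariety.isDominant_toSchemeHom_zsmul_of_ne_zero (P.A.fibre (φT t).left).toAbelianVariety hMΩ
      haveI := AbelianVariety.isDominant_toSchemeHom_zsmul_of_ne_zero (P.A.fibre (φT t₀).left).toAbelianVariety hMΩ
      (P.A.fibre (φT t).left).toAbelianVariety.weilPairingLevel Θ Pt Qt =
        (P.A.fibre (φT t₀).left).toAbelianVariety.weilPairingLevel Θ₀ P₀ Q₀ := by
  intro M hMΩ v w Pt Qt P₀ Q₀ hPt hQt hP₀ hQ₀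
  classical
  have hM0 : M ≠ 0 := by
    rintro rfl
    exact hMΩ (by simp)
  -- the readings `v`, `w` are `M`-division vectors (read off the torsion points at `t₀`)
  have hdivOf : ∀ (r : Fin g ⊕ Fin g → ℚ) (R : (P.A.fibre (φT t₀).left).toAbelianVariety.torsionPoints ℂ (M : ℤ)),
      P.A.fibrePointToLeft (φT t₀).left (R : (P.A.fibre (φT t₀).left).toAbelianVariety.Points ℂ) =
        (φA (ex₁ (t₀, Φ₁ t₀ (fun j => (r j : ℝ))))).left → ∀ i, ∃ k : ℤ, (M : ℝ) * (fun j => (r j : ℝ)) i = k := by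
    intro r R hR
    have hRM : (R : (P.A.fibre (φT t₀).left).toAbelianVariety.Points ℂ) ^ M = 1 := by
      rw [← zpow_natCast]
      exact (AbelianVariety.mem_torsionPoints_iff _ _).1 R.2
    obtain ⟨x, hxdiv, hx⟩ := exists_isDiv_reading_of_pow_eq_one' P.A φA hA (hG t₀ ht₀) _ hRM hR.symm
    obtain ⟨n, hn⟩ := hex₁.reading_unique_mod ht₀ hx.symm
    intro i
    obtain ⟨k, hk⟩ := hxdiv i
    refine ⟨k + M * n i, ?_⟩
    have : (fun j => (r j : ℝ)) = x + fun i => (n i : ℝ) := hn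
    rw [this]
    simp only [Pi.add_apply, mul_add, hk]
    push_cast
    ring
  have hvdiv := hdivOf v P₀ hP₀
  have hwdiv := hdivOf w Q₀ hQ₀
  -- canonical data at every `s ∈ V`: an ample witness and the chart torsion points of readings `v`, `w`
  -- the predicate «every pairing reading at `s` equals the reading at `t₀`»
  haveI inst₀ := AbelianVariety.isDominant_toSchemeHom_zsmul_of_ne_zero (P.A.fibre (φT t₀).left).toAbelianVariety hMΩ
  let c₀ : ℂ := (P.A.fibre (φT t₀).left).toAbelianVariety.weilPairingLevel Θ₀ P₀ Q₀
  let Good : MT → Prop := fun s =>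
    ∀ (Θ' : CartierDivisor (P.A.fibre (φT s).left).toAbelianVariety.X.left), P.A.IsLambdaOfAt (φT s).left P.D P.pol.lam Θ' →
      ∀ (R R' : (P.A.fibre (φT s).left).toAbelianVariety.torsionPoints ℂ (M : ℤ)),
        P.A.fibrePointToLeft (φT s).left (R : (P.A.fibre (φT s).left).toAbelianVariety.Points ℂ) =
            (φA (ex₁ (s, Φ₁ s (fun j => (v j : ℝ))))).left →
        P.A.fibrePointToLeft (φT s).left (R' : (P.A.fibre (φT s).left).toAbelianVariety.Points ℂ) =
            (φA (ex₁ (s, Φ₁ s (fun j => (w j : ℝ))))).left →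
        haveI := AbelianVariety.isDominant_toSchemeHom_zsmul_of_ne_zero (P.A.fibre (φT s).left).toAbelianVariety hMΩ
        (P.A.fibre (φT s).left).toAbelianVariety.weilPairingLevel Θ' R R' = c₀
  -- LOCAL CONSTANCY of `Good` on `V` (local head at `s₁` with the canonical data there)
  have hloc : ∀ s₁ ∈ V, ∀ᶠ s in 𝓝[V] s₁, (Good s ↔ Good s₁) := by
    intro s₁ hs₁
    obtain ⟨Θ₁, -, hlam₁⟩ := P.pol.exists_ample ℂ (φT s₁).left
    obtain ⟨P₁, hP₁⟩ := exists_torsionPoint_reading P.A φA (hG s₁ hs₁) hvdiv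
    obtain ⟨Q₁, hQ₁⟩ := exists_torsionPoint_reading P.A φA (hG s₁ hs₁) hwdiv
    have hev := eventually_pairingReading_eq P hT φA hA hex₁ hG hs₁ hMΩ v w P₁ Q₁ hP₁ hQ₁ Θ₁ hlam₁
    haveI := AbelianVariety.isDominant_toSchemeHom_zsmul_of_ne_zero (P.A.fibre (φT s₁).left).toAbelianVariety hMΩ
    -- at `s₁` itself every reading equals the canonical one
    have hself := hev.self_of_nhdsWithin hs₁
    filter_upwards [hev, self_mem_nhdsWithin] with s hs hsV
    constructor
    · intro hgood Θ' hΘ' R R' hR hR'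
      -- value at `s₁` = canonical value at `s₁` = value at `s` (data exist at `s`) = `c₀`
      obtain ⟨Θs, -, hlams⟩ := P.pol.exists_ample ℂ (φT s).left
      obtain ⟨Rs, hRs⟩ := exists_torsionPoint_reading P.A φA (hG s hsV) hvdiv
      obtain ⟨Rs', hRs'⟩ := exists_torsionPoint_reading P.A φA (hG s hsV) hwdiv
      rw [hself Θ' hΘ' R R' hR hR', ← hs Θs hlams Rs Rs' hRs hRs']
      exact hgood Θs hlams Rs Rs' hRs hRs'
    · intro hgood Θ' hΘ' R R' hR hR'
      rw [hs Θ' hΘ' R R' hR hR']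
      exact hgood Θ₁ hlam₁ P₁ Q₁ hP₁ hQ₁
  -- `Good` is constant on the preconnected `V`
  let f : MT → Bool := fun s => decide (Good s)
  have hf : ContinuousOn f V := by
    intro s₁ hs₁
    refine (continuousWithinAt_const (b := f s₁)).congr_of_eventuallyEq ?_ rfl
    filter_upwards [hloc s₁ hs₁] with s hs
    simp only [f, hs]
  have hgood₀ : Good t₀ := by
    intro Θ' hΘ' R R' hR hR'
    have hRP : R = P₀ := Subtype.ext (P.A.fibrePointToLeft_injective _ (hR.trans hP₀.symm))
    have hRQ : R' = Q₀ := Subtype.ext (P.A.fibrePointToLeft_injective _ (hR'.trans hQ₀.symm))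
    rw [hRP, hRQ]
    exact AbelianSchemeOver.IsLambdaOfAt.weilPairingLevel_eq P.A P.D P.pol.lam (φT t₀).left hΘ' hlam₀ P₀ Q₀
  have hft : f t = f t₀ := hV.constant hf ht ht₀
  have hgoodt : Good t := by
    have h0 : f t₀ = true := by simp [f, hgood₀]
    rw [h0] at hft
    simpa [f] using hft
  exact hgoodt Θ hlam Pt Qt hPt hQt

end RelativeExponentialChartPairingReadings

end Literature.AlgebraicGeometry.ModuliOfAbelianVarieties

end
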